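import Summits.HodgeConjecture.HodgeConjecture.Theorems.AnchorTransportVariationalHodgePadicEverywherePropagation
import Summits.HodgeConjecture.HodgeConjecture.Theorems.AnchorTransportVariationalHodgePadicGenericPropagationQP

/-!
# Route AnchorTransport — crux `VariationalHodge` (stmt-HodgeConjecture-1076), line `padic-disc-transport`:
# STUB G (`GenericPropagation`) for ALL smooth proper families — no quasi-projectivity of the total space

HONEST FRAMING: research route conditional on HC_CM; not a corollary; Q11.4-sentence-2 already refuted in dim ≥ 3.
Helper file on the crux item (nothing here closes it; no definition, no named fact, no `sorry`;
`HC_CM` does not occur). Cell `pub-hodge-ring2`, binder seat `ring2-b03` (gen 34), BINDER-OWNERS row b03.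

Sequel of `AnchorTransportVariationalHodgePadicEverywherePropagation.lean` (everywhere propagation
through a Mumford curve, algebraically closed countable field of definition). Here:

* `everywherePropagation_of_factor`, `everywherePropagation` — any countable `k`: factor `σ` through
  the algebraic closure `k̄ ↪ ℂ` (`exists_countable_isAlgClosed_factor`) and move every hypothesis and
  the conclusion along the isomorphism of complexified families (`baseChangeHomObjIsoOfComp_comm`,
  `AnchorTransportVariationalHodgePadicDescent`), exactly as gen 32's `uncountablePropagation`.
* `genericPropagation` — **STUB G (`PadicDiscTransport.GenericPropagation`) of the registered
  skeleton `Cruxes/VariationalHodge/Lines/padic_disc_transport.lean`, with its binders copied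
  VERBATIM and NO `IsQuasiProjectiveOver` hypothesis** (a `k`-generic complex point lies over the
  generic point of `S₀`, `base_pt_eq_genericPoint_of_isGenericPoint`, Charles–Schnell Lemma 11.3.14;
  then `everywherePropagation`). The lead of the line closes the stub with
  `theorem stub_genericPropagation : GenericPropagation := Theorems.genericPropagation`.

References: [VoisinHodgeII2003] §3.3.1; [CharlesSchnell2014Notes] Prop. 11.3.11 (proof),
Lemma 11.3.14; [Voisin2007HodgeLoci] §0; [AtiyahMacdonald1969] Cor. 5.9.
-/

noncomputable section

-- every declaration of this problem lives in `Summit.HodgeConjecture.HodgeConjecture.…` (summit = sub-problem)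
set_option linter.dupNamespace false

open CategoryTheory CategoryTheory.Limits AlgebraicGeometry TopologicalSpace Order
open Literature.AlgebraicGeometry.Motives Literature.AlgebraicGeometry.HodgeTheory

namespace Summit.HodgeConjecture.HodgeConjecture.Theorems

/-! ### Everywhere propagation, any countable field of definition -/

section General

variable {k k' : Type} [Field k] [Field k'] (σ : k →+* ℂ) (σ' : k →+* k') (τ : k' →+* ℂ)

/-- **Everywhere propagation along a factorisation `k → k' → ℂ`** with `k'` countable, algebraically
closed and integral over `k`: the statement of `everywherePropagation` for the family over `k`,
deduced from `everywherePropagation_of_isAlgClosed` for its base change to `k'` (the two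
complexifications are isomorphic families, `baseChangeHomObjIsoOfComp_comm`; all hypotheses and
the conclusion move along the isomorphism, and `s` stays over the generic point,
`closure_base_pt_eq_univ_of_factor`). [cite: VoisinHodgeII2003, §3.3.1]
[cite: CharlesSchnell2014Notes, Prop. 11.3.11 (proof) and Lemma 11.3.14] -/
theorem everywherePropagation_of_factor [Countable k'] [IsAlgClosed k'] (hσ' : σ'.IsIntegral)
    (hτσ : τ.comp σ' = σ) ⦃n : ℕ⦄ ⦃𝒳₀ S₀ : SchemeOver k⦄ (f₀ : 𝒳₀ ⟶ S₀)
    (hf : IsSmoothProjectiveFamily ((baseChangeHom σ).map f₀) n)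
    (hirr : IrreducibleSpace ((baseChangeHom σ).obj S₀).left)
    (haff : IsAffine ((baseChangeHom σ).obj S₀).left)
    (hsm : AlgebraicGeometry.Smooth ((baseChangeHom σ).obj S₀).hom)
    (hdim : topologicalKrullDim ((baseChangeHom σ).obj S₀).left = 1)
    (p : ℕ) (A : complexBetti ((baseChangeHom σ).obj 𝒳₀) (2 * p))
    (s : ComplexPoints ((baseChangeHom σ).obj S₀))
    (hs : closure {(baseChangeHomFst σ S₀).base s.pt} = (Set.univ : Set S₀.left))
    (hA : complexBetti.map (fiberι ((baseChangeHom σ).map f₀) s) (2 * p) A ∈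
      algebraicClasses (fiberOver ((baseChangeHom σ).map f₀) s) p)
    (u : ComplexPoints ((baseChangeHom σ).obj S₀)) :
    complexBetti.map (fiberι ((baseChangeHom σ).map f₀) u) (2 * p) A ∈
      algebraicClasses (fiberOver ((baseChangeHom σ).map f₀) u) p := by
  classical
  -- ### the isomorphism of complex families `(f₀ ⊗ k') ⊗ ℂ ≅ f₀ ⊗ ℂ`
  have comm : (baseChangeHom τ).map ((baseChangeHom σ').map f₀) ≫
      (baseChangeHomObjIsoOfComp σ' τ σ hτσ S₀).hom =
      (baseChangeHomObjIsoOfComp σ' τ σ hτσ 𝒳₀).hom ≫ (baseChangeHom σ).map f₀ :=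
    baseChangeHomObjIsoOfComp_comm σ' τ σ hτσ f₀
  -- ### transport of the hypotheses
  haveI := hirr
  haveI := haff
  haveI := hsm
  have hf' : IsSmoothProjectiveFamily ((baseChangeHom τ).map ((baseChangeHom σ').map f₀)) n :=
    IsSmoothProjectiveFamily.of_arrowIso _ _ comm hf
  obtain ⟨hirr', haff', hsm', hdim'⟩ :=
    base_hypotheses_of_iso (S' := (baseChangeHom τ).obj ((baseChangeHom σ').obj S₀))
      (baseChangeHomObjIsoOfComp σ' τ σ hτσ S₀) hdim
  have hA' := (map_fiberι_mem_algebraicClasses_iff_of_arrowIso _ _ comm A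
      (AlgPoints.map_hom_map_inv_apply (baseChangeHomObjIsoOfComp σ' τ σ hτσ S₀) s)).mpr hA
  haveI := hirr'
  haveI := hsm'
  have hs' := closure_base_pt_eq_univ_of_factor σ σ' τ hσ' hτσ S₀ s hs
  -- ### the algebraically closed case at `eS⁻¹ u`, and transport of the conclusion
  have key := everywherePropagation_of_isAlgClosed k' τ ((baseChangeHom σ').map f₀) hf' hirr'
    haff' hsm' hdim' p _ _ hs' hA'
    (AlgPoints.map (baseChangeHomObjIsoOfComp σ' τ σ hτσ S₀).inv u)
  exact (map_fiberι_mem_algebraicClasses_iff_of_arrowIso _ _ comm A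
    (AlgPoints.map_hom_map_inv_apply (baseChangeHomObjIsoOfComp σ' τ σ hτσ S₀) u)).1 key

/-- **EVERYWHERE PROPAGATION**, every countable field of definition `k`, no quasi-projectivity:
for `f₀ ⊗_σ ℂ : 𝒳 ⟶ S` a smooth projective family (smooth, proper, projective fibres) over a
smooth irreducible affine curve, `A ∈ H²ᵖ(𝒳(ℂ); ℂ)` and a complex point `s` over the generic
point of `S₀` with `A|_{𝒳_s}` algebraic, `A|_{𝒳_u}` is algebraic at every complex point `u`
(factor `σ` through the algebraic closure of `k` in `ℂ`, `exists_countable_isAlgClosed_factor`,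
and apply `everywherePropagation_of_factor`). [cite: VoisinHodgeII2003, §3.3.1]
[cite: CharlesSchnell2014Notes, Prop. 11.3.11 (proof) and Lemma 11.3.14] -/
theorem everywherePropagation (k : Type) [Field k] [Countable k] (σ : k →+* ℂ) ⦃n : ℕ⦄
    ⦃𝒳₀ S₀ : SchemeOver k⦄ (f₀ : 𝒳₀ ⟶ S₀)
    (hf : IsSmoothProjectiveFamily ((baseChangeHom σ).map f₀) n)
    (hirr : IrreducibleSpace ((baseChangeHom σ).obj S₀).left)
    (haff : IsAffine ((baseChangeHom σ).obj S₀).left)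
    (hsm : AlgebraicGeometry.Smooth ((baseChangeHom σ).obj S₀).hom)
    (hdim : topologicalKrullDim ((baseChangeHom σ).obj S₀).left = 1)
    (p : ℕ) (A : complexBetti ((baseChangeHom σ).obj 𝒳₀) (2 * p))
    (s : ComplexPoints ((baseChangeHom σ).obj S₀))
    (hs : closure {(baseChangeHomFst σ S₀).base s.pt} = (Set.univ : Set S₀.left))
    (hA : complexBetti.map (fiberι ((baseChangeHom σ).map f₀) s) (2 * p) A ∈
      algebraicClasses (fiberOver ((baseChangeHom σ).map f₀) s) p)
    (u : ComplexPoints ((baseChangeHom σ).obj S₀)) :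
    complexBetti.map (fiberι ((baseChangeHom σ).map f₀) u) (2 * p) A ∈
      algebraicClasses (fiberOver ((baseChangeHom σ).map f₀) u) p := by
  obtain ⟨k', _, _, _, σ', τ, hσ', hτσ⟩ := exists_countable_isAlgClosed_factor σ
  exact everywherePropagation_of_factor σ σ' τ hσ' hτσ f₀ hf hirr haff hsm hdim p A s hs hA u

end General

/-! ### STUB G, all smooth proper families -/

section StubG

/-- **STUB G (`PadicDiscTransport.GenericPropagation`) of line `padic-disc-transport`, PROVED AS
REGISTERED** — the statement with its binders copied verbatim, no quasi-projectivity hypothesis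
on the total space: for a smooth projective family base-changed from a countable field `k` over a
smooth irreducible affine curve, a global class algebraic on the fibre over ONE `k`-generic complex
point is algebraic on every fibre (a `k`-generic point lies over the generic point,
`base_pt_eq_genericPoint_of_isGenericPoint`; then `everywherePropagation`).
[cite: CharlesSchnell2014Notes, Prop. 11.3.11 and Lemma 11.3.14]
[cite: VoisinHodgeII2003, §3.3.1] [cite: Voisin2007HodgeLoci, §0 (Introduction), first paragraph] -/
theorem genericPropagation :
    ∀ (k : Type) [Field k] [Countable k] (σ : k →+* ℂ) ⦃n : ℕ⦄ ⦃𝒳₀ S₀ : SchemeOver k⦄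
      (f₀ : 𝒳₀ ⟶ S₀),
      IsSmoothProjectiveFamily ((baseChangeHom σ).map f₀) n →
      IrreducibleSpace ((baseChangeHom σ).obj S₀).left → IsAffine ((baseChangeHom σ).obj S₀).left →
      AlgebraicGeometry.Smooth ((baseChangeHom σ).obj S₀).hom →
      topologicalKrullDim ((baseChangeHom σ).obj S₀).left = 1 →
      ∀ (p : ℕ) (A : complexBetti ((baseChangeHom σ).obj 𝒳₀) (2 * p))
        (s : ComplexPoints ((baseChangeHom σ).obj S₀)),
        (∀ Z : Set (ComplexPoints ((baseChangeHom σ).obj S₀)),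
          IsDefinedOver σ S₀ σ.fieldRange Z → s ∈ Z → Z = Set.univ) →
        complexBetti.map (fiberι ((baseChangeHom σ).map f₀) s) (2 * p) A ∈
          algebraicClasses (fiberOver ((baseChangeHom σ).map f₀) s) p →
        ∀ t : ComplexPoints ((baseChangeHom σ).obj S₀),
          complexBetti.map (fiberι ((baseChangeHom σ).map f₀) t) (2 * p) A ∈
            algebraicClasses (fiberOver ((baseChangeHom σ).map f₀) t) p := by
  intro k _ _ σ n 𝒳₀ S₀ f₀ hf hirr haff hsm hdim p A s hs hA t
  haveI := hsm
  haveI := hirr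
  haveI := irreducibleSpace_of_baseChangeHom σ S₀
  have hgen : (baseChangeHomFst σ S₀).base s.pt = genericPoint S₀.left :=
    base_pt_eq_genericPoint_of_isGenericPoint σ S₀ hs
  have hdense : closure {(baseChangeHomFst σ S₀).base s.pt} = (Set.univ : Set S₀.left) := by
    rw [hgen]; exact genericPoint_closure _
  exact everywherePropagation k σ f₀ hf hirr haff hsm hdim p A s hdense hA t

end StubG

end Summit.HodgeConjecture.HodgeConjecture.Theorems

end
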